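import Summits.ResolutionOfSingularities.ResolutionOfSingularities.Theorems.EquisingularLiftEquisingularLiftNatValuationChartCentre
import Summits.ResolutionOfSingularities.ResolutionOfSingularities.Theorems.EquisingularLiftEquisingularLiftNatRibbonBad
import HarnessLib

/-!
# [OURS · L1 W4.5(b) · EL♮] K-VAL-CENTRE at scheme level: after a RIBBON touch the point of the blowing up under the
# `v`-centre is BAD, and `v` is centred there (DSHARP-VOID §2 (2a), kernel form)
# (crux `EquisingularLiftNat` = stmt-ResolutionOfSingularities-20038; PARENT ≥ 4 band / kill test #50 K5-BMY, door (d♯))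

HONEST FRAMING. OURS (cell res-hironaka, crux chain w45b, slot W4.5(b)); NOT a statement of any manuscript; replaces the role of
NOTHING in the manuscript; AI-written, AI review is weaker than expert review. Helper `--supports stmt-ResolutionOfSingularities-20038
--as helper`. Sequel of `…NatValuationChartCentre` (p563432, the ring-level valuation package over `blowupAlgebra`; object «(α)» of
res-L1-w45b-plan-1's NAMING 2026-08-27T19:21:12Z, taken by res-D-brk-4 g9 — NO OBJECTION 19:29:47Z).

WHAT THIS FILE ADDS.
* §1 `exists_valuation_of_isLocalization_atPrime` — DOMINATION, general ring form: a valuation `wB ≤ 1` on a ring `B` whose centre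
  is the prime `𝔮 = {wB < 1}` extends to every localisation `L` of `B` at `𝔮` with `≤ 1` on `L` and `< 1` exactly on `𝔪_L`.
* §2 `exists_point_algebra_of_blowupAlgebra_prime` — a COMPATIBLE READER for blow-up charts: for `IsBlowup π J`, generators `c` of
  `J_s`, an index `j` and a prime `𝔓` of `𝒪_{X,s}[J_s/c_j]` over `𝔪_s`, some `x′ ∈ X′` over `s` TOGETHER WITH a ring map
  `θ : 𝒪_{X,s}[J_s/c_j] → 𝒪_{X′,x′}` presenting `𝒪_{X′,x′}` as the localisation of the chart at `𝔓` (`IsLocalization.AtPrime` for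
  `θ.toAlgebra`) and restricting to `π^♯_{x′}` on `𝒪_{X,s}` (through the specialisation isomorphism `𝒪_{X,s} ≅ 𝒪_{X,π x′}`). The
  tree's readers `ChartPoint.exists_point_isRegularLocalRing_iff_of_blowupAlgebra_prime` (p550611: a bare ring iso) and
  `RibbonBad.exists_point_varpiGerm_mem_sq_of_chart_prime` (p557704: one consequence) are both instances; the structure map is what a
  valuation needs to travel.
* §3 `exists_point_bad_dominated_of_ribbon` — THE (2a) STATEMENT: blowing up `π : X′ → X` along `J`, base `r : X → Spec O`, `ϖ ∈ O`,
  generators `c` of `J_s` with `c_j ∈ 𝔪_s`, a member `g ∈ J_s` with `ϖ_s − g ∈ 𝔪_s²` (RIBBON touch), and a valuation `v` of `𝒪_{X,s}`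
  (support allowed — in the K5-BMY application `v` lives on the function field of the hypersurface `Y ⊂ P` and is pulled back to the
  regular ambient stalk) with `v ≤ 1`, centred at `𝔪_s`, `v(c_j)` minimal among the generators and nonzero, `v g < v (c j)`
  (multiplicative notation: «`v(g) > v(y₁)`»). THEN: some `x′ ∈ X′` over `s` is BAD (germ of `ϖ` w.r.t. `π ≫ r` in `𝔪_{x′}²`, the
  `…NatBadLocus` currency) AND `v` is centred at `x′` (a valuation `w′ ≤ 1` of `𝒪_{X′,x′}`, `< 1` exactly on `𝔪_{x′}`,
  `w′ ∘ π^♯_{x′} = v`). Proof: `ValChartCentre.exists_centre_ribbon` (the centre `𝔓_v` of the extension of `v` on the chart lies over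
  `𝔪_s` on the hyperplane `{g/c_j = 0}`) + K-RIBBON-BAD ring form `RibbonBad.algebraMap_mem_sq` (`ϖ_s ∈ 𝔓_v²`) + §2 + §1.
  By uniqueness of the centre of a valuation on a scheme separated over the base (valuative criterion; the by-hand sentence of
  `DSHARP-VOID.md` §2 (2a) «by uniqueness of centres `x′(𝔓_v) = η_{Z_{j+1}}`»), `x′` is THE centre of `v` on `X′`: after a ribbon
  touch the `v`-centre sits at a BAD point, and by persistence (`…NatBadLocus.not_goodAt_of_bad_below`) so do all later centres.

HYPOTHESIS SHAPES OF K-RIBBON-BAD, VERBATIM (p557704 `RibbonBad.exists_point_bad_of_ribbon`; res-L1-w45b-plan-1 19:29:47Z asked that the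
valuation package land in exactly these shapes):
  `(hM : (maximalIdeal (X.presheaf.stalk s)).map (algebraMap _ (blowupAlgebra (Ideal.span (Set.range c)) (c j))) ≤ 𝔓.asIdeal)`
  `(hw : algebraMap _ (blowupAlgebra (Ideal.span (Set.range c)) (c j)) g ∈`
  `   𝔓.asIdeal * Ideal.span {algebraMap _ (blowupAlgebra (Ideal.span (Set.range c)) (c j)) (c j)})`
— they are the second and third conjuncts of `ValChartCentre.exists_centre_ribbon` (p563432) at `R := X.presheaf.stalk s`,
`J := Ideal.span (Set.range c)`, `a := c j`; §3 below feeds them (and the first conjunct, the `h𝔓` of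
`RibbonBad.exists_point_varpiGerm_mem_sq_of_chart_prime`) to the K-RIBBON-BAD ring form `RibbonBad.algebraMap_mem_sq` by term
application, which is the kernel check that the shapes agree.

References: tree `…BlowupStalkCharts` (`exists_stalk_ringHom_of_chart`; [StacksProject, Tag 0804]), `…LipmanValuativeQuadraticSequenceProofs`
(`IsBlowup.exists_chart_morphism_of_index`; its `chartCentre` is the field-embedded twin of `𝔓_v` for integral `X`), `…AffineBlowupAlgebra`
(`reesChartEquiv`), `…NatBlowupChartPoint`, `…NatRibbonBad`, `…NatBadLocus` (`varpiGerm_comp`); Mathlib `Valuation.extendToLocalization`,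
`IsLocalization.isLocalization_of_base_ringEquiv`; [ZariskiSamuel1960, Ch. VI §5]; [GortzWedhorn2020, (13.19)].
-/

set_option linter.dupNamespace false -- mandated namespace `Summit.<Summit>.<Problem>` of this single-conjunct summit

noncomputable section

universe u v

open IsLocalRing IsLocalization
open Literature.AlgebraicGeometry.Resolution

namespace Summit.ResolutionOfSingularities.ResolutionOfSingularities.Cruxes.EquisingularLiftNat.Sections

namespace ValChartCentre

/-! ## §1 Domination of a localisation at the centre (general ring form) -/

section General

variable {B : Type u} [CommRing B] {Γ : Type v} [LinearOrderedCommGroupWithZero Γ]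

/-- **Domination, general form.** A valuation `wB ≤ 1` on a ring `B` and an ideal `𝔮` with `b ∈ 𝔮 ↔ wB b < 1` (its centre): `wB`
extends to every localisation `L` of `B` at `𝔮` with `≤ 1` on `L` and `< 1` exactly on `𝔪_L`. [folklore] -/
theorem exists_valuation_of_isLocalization_atPrime (wB : Valuation B Γ) (hle : ∀ b, wB b ≤ 1) (𝔮 : Ideal B) [𝔮.IsPrime]
    (h𝔮 : ∀ b, b ∈ 𝔮 ↔ wB b < 1) (L : Type*) [CommRing L] [IsLocalRing L] [Algebra B L] [IsLocalization.AtPrime L 𝔮] :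
    ∃ wL : Valuation L Γ, (∀ y, wL y ≤ 1) ∧ (∀ y, wL y < 1 ↔ y ∈ maximalIdeal L) ∧
      ∀ b, wL (algebraMap B L b) = wB b := by
  have hone : ∀ t : B, t ∉ 𝔮 → wB t = 1 := fun t ht =>
    le_antisymm (hle t) (not_lt.mp (fun h => ht ((h𝔮 t).mpr h)))
  have hS : 𝔮.primeCompl ≤ wB.supp.primeCompl := by
    intro t ht
    show t ∉ wB.supp
    rw [Valuation.mem_supp_iff, hone t ht]
    exact one_ne_zero
  refine ⟨wB.extendToLocalization hS L, ?_, ?_, fun b => ?_⟩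
  · intro y
    obtain ⟨⟨z, t⟩, rfl⟩ := IsLocalization.mk'_surjective 𝔮.primeCompl y
    show wB.extendToLocalization hS L (IsLocalization.mk' L z t) ≤ 1
    rw [Valuation.extendToLocalization_mk', hone t t.2, inv_one, mul_one]
    exact hle z
  · intro y
    obtain ⟨⟨z, t⟩, rfl⟩ := IsLocalization.mk'_surjective 𝔮.primeCompl y
    show wB.extendToLocalization hS L (IsLocalization.mk' L z t) < 1 ↔ IsLocalization.mk' L z t ∈ maximalIdeal L
    rw [Valuation.extendToLocalization_mk', hone t t.2, inv_one, mul_one, ← h𝔮,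
      IsLocalization.AtPrime.mk'_mem_maximal_iff L 𝔮 z t]
  · rw [Valuation.extendToLocalization_apply_map_apply]

end General

/-! ## §2 A COMPATIBLE reader: a chart prime over `𝔪_s` is a point of the blow-up, with its structure map -/

section Scheme

open CategoryTheory AlgebraicGeometry TopologicalSpace
open AlgebraicGeometry.Scheme.IdealSheafData

variable {X' X : Scheme.{0}} {π : X' ⟶ X} {J : X.IdealSheafData}

set_option maxHeartbeats 1600000 in
/-- **COMPATIBLE READER.** For a blowing up `π : X′ → X` along `J` (`IsBlowup`), generators `c` of `J_s`, an index `j` and a prime `𝔓`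
of the chart `𝒪_{X,s}[J_s/c_j]` (`blowupAlgebra`) lying over `𝔪_s`: some point `x′ ∈ X′` over `s` TOGETHER WITH a ring map
`θ : 𝒪_{X,s}[J_s/c_j] → 𝒪_{X′,x′}` presenting `𝒪_{X′,x′}` as the localisation of the chart at `𝔓` and restricting on `𝒪_{X,s}` to
`π^♯_{x′}` (through the specialisation isomorphism `𝒪_{X,s} ≅ 𝒪_{X,π x′}`). This refines the tree's readers `ChartPoint.…` (p550611,
bare iso) and `RibbonBad.exists_point_varpiGerm_mem_sq_of_chart_prime` (p557704) by exposing the structure map. OURS.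
[cite: StacksProject, Tag 0804] -/
theorem exists_point_algebra_of_blowupAlgebra_prime (hπ : IsBlowup π J) (s : X) {k : ℕ} (c : Fin k → X.presheaf.stalk s)
    (hc : Ideal.span (Set.range c) = stalkIdeal J s) (j : Fin k)
    (𝔓 : PrimeSpectrum (blowupAlgebra (Ideal.span (Set.range c)) (c j)))
    (h𝔓 : 𝔓.asIdeal.comap (algebraMap _ (blowupAlgebra (Ideal.span (Set.range c)) (c j))) = maximalIdeal (X.presheaf.stalk s)) :
    ∃ (x' : X') (hx : π x' = s) (θ : blowupAlgebra (Ideal.span (Set.range c)) (c j) →+* X'.presheaf.stalk x'),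
      @IsLocalization.AtPrime _ _ (X'.presheaf.stalk x') _ θ.toAlgebra 𝔓.asIdeal _ ∧
      ∀ t : X.presheaf.stalk s, θ (algebraMap _ (blowupAlgebra (Ideal.span (Set.range c)) (c j)) t) =
        (π.stalkMap x').hom ((X.presheaf.stalkSpecializes (specializes_of_eq hx)).hom t) := by
  let ε : (CommRingCat.of (chartRing c j) : Type) ≃+* blowupAlgebra (Ideal.span (Set.range c)) (c j) :=
    reesChartEquiv (I := Ideal.span (Set.range c)) (c j) (Ideal.mem_span_range_self (f := c) (x := j))
  have hε : ∀ a, ε (chartBase c j a) = algebraMap _ (blowupAlgebra (Ideal.span (Set.range c)) (c j)) a :=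
    reesChartEquiv_reesChartBase (c j) _
  -- the corresponding prime `𝔴 = ε⁻¹ 𝔓` of the Rees chart, again over `𝔪_s`
  let w : Spec (.of (chartRing c j)) := ⟨𝔓.asIdeal.comap ε, inferInstance⟩
  have hwmem : ∀ b, b ∈ w.asIdeal ↔ ε b ∈ 𝔓.asIdeal := fun b => Iff.rfl
  have hw : w.asIdeal.comap (chartBase c j) = maximalIdeal (X.presheaf.stalk s) := by
    ext a
    rw [Ideal.mem_comap, hwmem, hε, ← h𝔓, Ideal.mem_comap]
  -- the chart morphism `q : Spec B_j → X′` and the point `x′ = q 𝔴` over `s`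
  obtain ⟨q, hiso, hsq⟩ := IsBlowup.exists_chart_morphism_of_index hπ s c hc j
  have hx : π (q w) = s := by
    have h1 : (q ≫ π) w = π (q w) := Scheme.Hom.comp_apply q π w
    rw [← h1, hsq]
    exact ChartPoint.fromSpecStalk_Spec_map_apply_eq (B := CommRingCat.of (chartRing c j)) s (chartBase c j) w hw
  haveI := hiso w
  -- the chart structure map, re-based at the point `π (q 𝔴)` (`= s`) through the specialization isomorphism
  have hsp : s ⤳ π (q w) := specializes_of_eq hx.symm
  let φ : X.presheaf.stalk (π (q w)) ⟶ CommRingCat.of (chartRing c j) :=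
    X.presheaf.stalkSpecializes hsp ≫ CommRingCat.ofHom (chartBase c j)
  have hsq' : q ≫ π = Spec.map φ ≫ X.fromSpecStalk (π (q w)) := by
    rw [hsq, Spec.map_comp, Category.assoc, Scheme.SpecMap_stalkSpecializes_fromSpecStalk]
    rfl
  have HH := exists_stalk_ringHom_of_chart π (q w) φ q w rfl hsq'
  have hχ := HH.choose_spec.1
  have hloc := HH.choose_spec.2.1
  -- transport the localisation statement along `ε : B_j ≅ 𝒪_{X,s}[J_s/c_j]`
  have H : Submonoid.map ε w.asIdeal.primeCompl = 𝔓.asIdeal.primeCompl := by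
    ext b
    constructor
    · rintro ⟨a, ha, rfl⟩
      exact fun hb => ha ((hwmem a).mpr hb)
    · intro hb
      refine ⟨ε.symm b, fun ha => hb ?_, ε.apply_symm_apply b⟩
      have := (hwmem _).mp ha
      rwa [RingEquiv.apply_symm_apply] at this
  letI algB : Algebra (chartRing c j) (X'.presheaf.stalk (q w)) := HH.choose.toAlgebra
  haveI hlocB : IsLocalization.AtPrime (X'.presheaf.stalk (q w)) w.asIdeal := hloc
  have hlocP := IsLocalization.isLocalization_of_base_ringEquiv (w.asIdeal.primeCompl) (X'.presheaf.stalk (q w)) ε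
  rw [H] at hlocP
  let θ : blowupAlgebra (Ideal.span (Set.range c)) (c j) →+* X'.presheaf.stalk (q w) :=
    HH.choose.comp ε.symm.toRingHom
  refine ⟨q w, hx, θ, hlocP, fun t => ?_⟩
  -- compatibility: `θ (t/1) = χ (ε⁻¹ (ε (chartBase t))) = χ (chartBase t) = χ (φ t″) = π^♯ t″`, `t″` the re-based germ
  have e1 : θ (algebraMap _ (blowupAlgebra (Ideal.span (Set.range c)) (c j)) t) = HH.choose (chartBase c j t) := by
    show HH.choose (ε.symm (algebraMap _ (blowupAlgebra (Ideal.span (Set.range c)) (c j)) t)) = _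
    rw [← hε, RingEquiv.symm_apply_apply]
  have e2 : (X.presheaf.stalkSpecializes hsp).hom
      ((X.presheaf.stalkSpecializes (specializes_of_eq hx)).hom t) = t := by
    rw [← CommRingCat.comp_apply, TopCat.Presheaf.stalkSpecializes_comp]
    rw [show X.presheaf.stalkSpecializes ((specializes_of_eq hx.symm).trans (specializes_of_eq hx)) = 𝟙 _ from
      X.presheaf.stalkSpecializes_refl s]
    rfl
  have e3 : φ.hom ((X.presheaf.stalkSpecializes (specializes_of_eq hx)).hom t) = chartBase c j t := by
    show chartBase c j ((X.presheaf.stalkSpecializes hsp).hom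
      ((X.presheaf.stalkSpecializes (specializes_of_eq hx)).hom t)) = _
    rw [e2]
  rw [e1, ← e3, hχ]

/-! ## §3 After a RIBBON touch the point under the `v`-centre is BAD, and `v` is centred there -/

/-- **K-VAL-CENTRE at scheme level (DSHARP-VOID §2 (2a), kernel form).** Data: a blowing up `π : X′ → X` along `J`, a base
`r : X → Spec O` with `ϖ ∈ O`, a point `s`, generators `c` of `J_s` with `c_j ∈ 𝔪_s`, a member `g ∈ J_s` with `ϖ_s − g ∈ 𝔪_s²`
(RIBBON touch), and a valuation `v` of `𝒪_{X,s}` (support allowed) with `v ≤ 1`, centred at `𝔪_s` (`v t < 1 ↔ t ∈ 𝔪_s`), for which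
`c_j` has MINIMAL value among the generators (`v(c_j) = v(J_s)`, `v (c j) ≠ 0`) and `v g < v (c j)` («`v(g) > v(y₁)`»). Then there is
a point `x′ ∈ X′` over `s` which is BAD — the germ of `ϖ` at `x′` (w.r.t. `π ≫ r`, the `…NatBadLocus` currency) lies in `𝔪_{x′}²` — and
AT WHICH `v` IS CENTRED: a valuation `w′` of `𝒪_{X′,x′}` with `w′ ≤ 1`, `w′ < 1` exactly on `𝔪_{x′}`, and `w′ ∘ π^♯_{x′} = v` on
`𝒪_{X,s}` (through the specialisation isomorphism `𝒪_{X,s} ≅ 𝒪_{X,π x′}`). With the uniqueness of the centre of a valuation on a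
scheme separated over the base (valuative criterion; by hand in `DSHARP-VOID.md`), `x′` is THE centre of `v` on `X′`: the `v`-centre
jumps onto the bad line. OURS. [folklore] -/
theorem exists_point_bad_dominated_of_ribbon {O : Type} [CommRing O] (r : X ⟶ Spec (.of O)) (ϖ : O)
    (hπ : IsBlowup π J) (s : X) {k : ℕ} (c : Fin k → X.presheaf.stalk s)
    (hc : Ideal.span (Set.range c) = stalkIdeal J s) (j : Fin k) (hcj : c j ∈ maximalIdeal (X.presheaf.stalk s))
    {g : X.presheaf.stalk s} (hg : g ∈ Ideal.span (Set.range c))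
    (hrib : (X.presheaf.Γgerm s).hom (r.appTop.hom ((Scheme.ΓSpecIso (.of O)).inv.hom ϖ)) - g ∈
      (maximalIdeal (X.presheaf.stalk s)) ^ 2)
    {Γ : Type v} [LinearOrderedCommGroupWithZero Γ] (v : Valuation (X.presheaf.stalk s) Γ) (hR : ∀ t, v t ≤ 1)
    (hcent : ∀ t, v t < 1 ↔ t ∈ maximalIdeal (X.presheaf.stalk s)) (ha : v (c j) ≠ 0) (hmin : ∀ i, v (c i) ≤ v (c j))
    (hvg : v g < v (c j)) :
    ∃ (x' : X') (hx : π x' = s),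
      (X'.presheaf.Γgerm x').hom ((π ≫ r).appTop.hom ((Scheme.ΓSpecIso (.of O)).inv.hom ϖ)) ∈
        (maximalIdeal (X'.presheaf.stalk x')) ^ 2 ∧
      ∃ w' : Valuation (X'.presheaf.stalk x') Γ, (∀ y, w' y ≤ 1) ∧ (∀ y, w' y < 1 ↔ y ∈ maximalIdeal (X'.presheaf.stalk x')) ∧
        ∀ t : X.presheaf.stalk s, w' ((π.stalkMap x').hom ((X.presheaf.stalkSpecializes (specializes_of_eq hx)).hom t)) = v t := by
  -- ring level: the centre `𝔓_v` of the extension `w` of `v` on the chart at `c_j`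
  have hJ : ∀ x ∈ Ideal.span (Set.range c), v x ≤ v (c j) :=
    forall_mem_span_le v hR (by rintro _ ⟨i, rfl⟩; exact hmin i)
  obtain ⟨w, hw⟩ := exists_valuation_away v ha
  obtain ⟨𝔓, hcomap, hM, hwg, h𝔓⟩ := exists_centre_ribbon v hR hcent ha hJ hw hg hvg
  -- the point under `𝔓_v`, with its structure map
  obtain ⟨x', hx, θ, hloc, hθ⟩ := exists_point_algebra_of_blowupAlgebra_prime hπ s c hc j 𝔓 hcomap
  refine ⟨x', hx, ?_, ?_⟩
  · -- BAD: `ϖ_s/1 ∈ 𝔓²` (K-RIBBON-BAD ring form) and `θ(𝔓) ⊆ 𝔪_{x′}`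
    letI := θ.toAlgebra
    haveI : IsLocalization.AtPrime (X'.presheaf.stalk x') 𝔓.asIdeal := hloc
    have hbad := RibbonBad.algebraMap_mem_sq hcj hrib 𝔓.asIdeal hM hwg
    have hθP : 𝔓.asIdeal.map θ ≤ maximalIdeal (X'.presheaf.stalk x') := by
      rw [Ideal.map_le_iff_le_comap]
      intro b hb
      rw [Ideal.mem_comap]
      have : algebraMap _ (X'.presheaf.stalk x') b ∈ maximalIdeal (X'.presheaf.stalk x') :=
        (IsLocalization.AtPrime.to_map_mem_maximal_iff (X'.presheaf.stalk x') 𝔓.asIdeal b).mpr hb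
      exact this
    have key : θ (algebraMap _ (blowupAlgebra (Ideal.span (Set.range c)) (c j))
        ((X.presheaf.Γgerm s).hom (r.appTop.hom ((Scheme.ΓSpecIso (.of O)).inv.hom ϖ)))) ∈
        (maximalIdeal (X'.presheaf.stalk x')) ^ 2 := by
      have hle : (𝔓.asIdeal ^ 2).map θ ≤ (maximalIdeal (X'.presheaf.stalk x')) ^ 2 := by
        rw [Ideal.map_pow]
        exact Ideal.pow_right_mono hθP 2
      exact hle (Ideal.mem_map_of_mem θ hbad)
    rw [hθ] at key
    -- the germ of `ϖ` at `x′` is `π^♯_{x′}` of the re-based germ `ϖ_{π x′}`, which is the specialisation of `ϖ_s`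
    rw [varpiGerm_comp r (π ≫ r) π rfl x' ϖ]
    have e : (X.presheaf.Γgerm (π x')).hom (r.appTop.hom ((Scheme.ΓSpecIso (.of O)).inv.hom ϖ)) =
        (X.presheaf.stalkSpecializes (specializes_of_eq hx)).hom
          ((X.presheaf.Γgerm s).hom (r.appTop.hom ((Scheme.ΓSpecIso (.of O)).inv.hom ϖ))) := by
      rw [TopCat.Presheaf.Γgerm, TopCat.Presheaf.Γgerm, TopCat.Presheaf.germ_stalkSpecializes_apply]
    rw [e]
    exact key
  · -- DOMINATION: `w` restricted to the chart extends to the localisation `𝒪_{X′,x′}` at `𝔓_v`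
    letI := θ.toAlgebra
    haveI : IsLocalization.AtPrime (X'.presheaf.stalk x') 𝔓.asIdeal := hloc
    obtain ⟨wL, h1, h2, h3⟩ := exists_valuation_atPrime v hw h𝔓 hR ha hJ (X'.presheaf.stalk x')
    refine ⟨wL, h1, h2, fun t => ?_⟩
    rw [← hθ]
    have : θ (algebraMap _ (blowupAlgebra (Ideal.span (Set.range c)) (c j)) t) =
        algebraMap (blowupAlgebra (Ideal.span (Set.range c)) (c j)) (X'.presheaf.stalk x')
          (algebraMap _ (blowupAlgebra (Ideal.span (Set.range c)) (c j)) t) := rfl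
    rw [this, h3]
    exact hw t

end Scheme

end ValChartCentre

end Summit.ResolutionOfSingularities.ResolutionOfSingularities.Cruxes.EquisingularLiftNat.Sections
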